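import Summits.AtomisticToContinuum.BoseEinsteinCondensation.Theses.BECThomsonPrinciple
import Summits.AtomisticToContinuum.BoseEinsteinCondensation.Theorems.BECInfraredBoundAssembly
import Literature.MathematicalPhysics.QuantumManyBody.BoseGasBoundaryConditionIndependence
import Literature.MathematicalPhysics.QuantumManyBody.BoseGasDirichletWall
import Literature.MathematicalPhysics.QuantumManyBody.DiluteBoseGasUpperBoundLocalization
import Literature.MathematicalPhysics.QuantumManyBody.ThermalExpectation
import Literature.MathematicalPhysics.QuantumManyBody.BoseGasCutoffStateEnergy
import Literature.MathematicalPhysics.QuantumManyBody.BoseGasPaddingStates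
import Literature.MathematicalPhysics.QuantumManyBody.BoseGasBoxModeNested

/-!
# Route `BECThomsonPrinciple`, crux `PeriodicToDirichlet` (stmt-AtomisticToContinuum-9483),
# line `reward-pays-the-wall` — vocabulary and registered stub statements

This is the `Defs` + composition file of the crux line `reward-pays-the-wall`
(`Summits/AtomisticToContinuum/BoseEinsteinCondensation/Cruxes/PeriodicToDirichlet/Lines/reward-pays-the-wall.{md,lean}`,
idea card `…/Ideas/reward-pays-the-wall.md`, triage r1-1/2/3: pass; lead's reshape). It holds

* the objects the line posits: the number-conserving rewarded functional
  `rewardedEnergy v λ Ψ = ⟨Ψ,HΨ⟩ + λ (N - n_φ(Ψ))` for the flat mode `φ = L^{-3/2} 1_{Λ_L}` of the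
  Dirichlet box (the tree's `boxConstantMode`, `ThermalExpectation.lean`) and its infimum
  `rewardedInf`; the cut-off of a torus wave function is written as the raw lambda
  `fun X => Ψ.ψ (X + fun _ => u) * ∏_{i,k} q (X i k)` of `DiluteBoseGasUpperBoundLocalization.lean`
  (named `cutoffFun` / `cutoffTrialState` in `BoseGasCutoffState.lean`, definitionally), so that no
  stub signature depends on anything but long-built modules;
* the predicates `TorusBECAt` (the body of the crux hypothesis `PeriodicBEC` at one `(v, ρ, c)`),
  `RewardedBoxBECAt`, `RewardedUpperBound`;
* the STATEMENTS of the registered stubs of the line's skeleton (`CutoffEnergy`, `PaddingStates`,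
  `FlatModeNested`, `CutoffOccupation`, `MergeOccupation`, `PaddedCutoffState`,
  `RewardedUpperBoundOfTorusBEC`, `RewardSandwich`, `Unrewarding`) as named, deliberately untagged
  `Prop`s — intermediate statements of a proof plan, not results in print (the audit's advisory
  `vendored-fact` class for witness-less `def : Prop` is expected until the stub files
  `Theorems/BECThomsonPrinciplePeriodicToDirichlet<Stub>.lean`, landed `--supports
  stmt-AtomisticToContinuum-9483`, provide the witnesses). `Unrewarding` is the line's open
  residual (a `λ → 0⁺`/`N → ∞` interchange for a number-conserving reward in one cube; barrier
  `SymmetryBreakingWithoutCondensate`), held by the lead;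
* the elementary facts (variational principle for the rewarded functional, `E₀^D ≤ F^D(λ)`, the
  Dirichlet wall under `F^D`, `R_0 = energy`, monotonicity in the constant) and the glue
  `RewardedBoxBECAt v ρ 0 c → HasGroundStateBEC v ρ`;
* the proof of the registered stub `stub_cutoffEnergy : CutoffEnergy ∧ PaddingStates ∧
  FlatModeNested` from the generic Literature theorems (this is the stub this file lands with).

Composition of the seven registered stubs (skeleton `Lines/reward-pays-the-wall.lean`, sorry-free
glue = the planner's `PeriodicToDirichlet_of`): `stub_cutoffEnergy`,
`stub_cutoffOccupation : CutoffOccupation`, `stub_mergeOccupation : MergeOccupation` feed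
`stub_paddedCutoffState : … → PaddedCutoffState`; then `stub_rewardedUpperBound` (uses the crux
hypothesis once, at `(v, ρ)`), `stub_rewardSandwich`, `stub_unrewarding` give the crux by name.

References: Basti–Cenatiempo–Schlein 2021, App. A, Lemma A.1 (cut-off); Ruelle 1969, §3.5.11
(merging of Dirichlet states with disjoint supports); LSSY 2005, §1.2 (1.17)–(1.19), Ch. 2 after
(2.2), App. D (D.15)–(D.19); Griffiths 1966, §II.
-/

noncomputable section

open MeasureTheory Filter
open scoped ENNReal NNReal

namespace Summit.AtomisticToContinuum.BoseEinsteinCondensation.RewardPaysTheWall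

open Literature.MathematicalPhysics.QuantumManyBody.BoseGas

/-! ## Objects -/

/-- The **rewarded Dirichlet functional** `R_λ(Ψ) = ⟨Ψ, H_N Ψ⟩ + λ (N - ⟨Ψ, n̂_φ Ψ⟩)`, `φ` the flat
mode `boxConstantMode L` of the box, written additively in `ℝ≥0∞` (number-conserving reward `λ`
for occupying `φ`; `R_0 = ⟨Ψ, HΨ⟩`, `rewardedEnergy_zero`). [folklore] -/
def rewardedEnergy (v : ℝ → ℝ≥0∞) (lam : ℝ) {N : ℕ} {L : ℝ} (Ψ : TrialState N L) : ℝ≥0∞ :=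
  energy v Ψ + ENNReal.ofReal lam * ((N : ℝ≥0∞) - occupation N (boxConstantMode L) Ψ.ψ)

/-- The rewarded ground-state energy `F^D(λ; N, L) = inf_Ψ R_λ(Ψ)` over Dirichlet trial states (an
infimum of functions affine in `λ`). [folklore] -/
def rewardedInf (v : ℝ → ℝ≥0∞) (lam : ℝ) (N : ℕ) (L : ℝ) : ℝ≥0∞ :=
  ⨅ Ψ : TrialState N L, rewardedEnergy v lam Ψ

/-! ## Predicates -/

/-- **Torus BEC at one density with a named constant**: the body of the crux hypothesis
`PeriodicBEC` at `(v, ρ, c)` — eventually in `N` there is a slack `δ > 0` such that every periodic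
trial state on the torus of side `L_N = (N/ρ)^{1/3}` within `δ` of `E₀^per` has constant-mode
occupation `≥ c N` (syntactically the inner body of `BECThomsonPrinciple.PeriodicToDirichlet`'s
antecedent). [folklore] -/
def TorusBECAt (v : ℝ → ℝ≥0∞) (ρ c : ℝ) : Prop :=
  ∀ᶠ N : ℕ in atTop, ∃ δ : ℝ≥0∞, 0 < δ ∧
    ∀ Ψ : PeriodicTrialState N (sideLength ρ N),
      periodicEnergy v Ψ ≤ periodicGroundStateEnergy v N (sideLength ρ N) + δ →
        ENNReal.ofReal (c * N) ≤ condensateOccupation N (sideLength ρ N) Ψ.ψ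

/-- **Rewarded flat-mode BEC in the Dirichlet box** at density `ρ`, reward `λ`, constant `c`:
eventually in `N` there is `δ > 0` such that every `δ`-near-minimiser of `R_λ` in the box of side
`L_N = (N/ρ)^{1/3}` has flat-mode occupation `≥ c N`. At `λ = 0` this is flat-mode BEC of the
unrewarded Dirichlet near-minimisers (`hasGroundStateBEC_of_rewardedBoxBECAt_zero`). [folklore] -/
def RewardedBoxBECAt (v : ℝ → ℝ≥0∞) (ρ lam c : ℝ) : Prop :=
  ∀ᶠ N : ℕ in atTop, ∃ δ : ℝ≥0∞, 0 < δ ∧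
    ∀ Ψ : TrialState N (sideLength ρ N),
      rewardedEnergy v lam Ψ ≤ rewardedInf v lam N (sideLength ρ N) + δ →
        ENNReal.ofReal (c * N) ≤ occupation N (boxConstantMode (sideLength ρ N)) Ψ.ψ

/-- **The rewarded upper bound**: for every `θ > 0` and every reward `λ ≥ 0`, eventually in `N`,
`F^D(λ; N, L_N(ρ)) ≤ N (e₀(ρ) + θ + λ (1 - c + θ))`, `e₀(ρ) = e0 v ρ` the tree's thermodynamic-limit
energy per particle. [folklore] -/
def RewardedUpperBound (v : ℝ → ℝ≥0∞) (ρ c : ℝ) : Prop :=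
  ∀ θ : ℝ, 0 < θ → ∀ lam : ℝ, 0 ≤ lam → ∀ᶠ N : ℕ in atTop,
    rewardedInf v lam N (sideLength ρ N) ≤
      ENNReal.ofReal ((N : ℝ) * ((e0 v ρ).toReal + θ + lam * (1 - c + θ)))

/-! ## Elementary facts (proved) -/

/-- Variational principle for the rewarded functional. [folklore] -/
theorem rewardedInf_le (v : ℝ → ℝ≥0∞) (lam : ℝ) {N : ℕ} {L : ℝ} (Ψ : TrialState N L) :
    rewardedInf v lam N L ≤ rewardedEnergy v lam Ψ :=
  iInf_le _ Ψ

/-- The reward is non-negative: `⟨Ψ, HΨ⟩ ≤ R_λ(Ψ)`. [folklore] -/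
theorem energy_le_rewardedEnergy (v : ℝ → ℝ≥0∞) (lam : ℝ) {N : ℕ} {L : ℝ} (Ψ : TrialState N L) :
    energy v Ψ ≤ rewardedEnergy v lam Ψ :=
  le_self_add

/-- Hence `E₀^D ≤ F^D(λ)`. [folklore] -/
theorem groundStateEnergy_le_rewardedInf (v : ℝ → ℝ≥0∞) (lam : ℝ) (N : ℕ) (L : ℝ) :
    groundStateEnergy v N L ≤ rewardedInf v lam N L :=
  le_iInf fun Ψ => (groundStateEnergy_le_energy v Ψ).trans (energy_le_rewardedEnergy v lam Ψ)

/-- In particular the rewarded infimum carries the Dirichlet wall `π²/(8L²)`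
(`BoseGasDirichletWall.dirichlet_wall`). [folklore] -/
theorem wall_le_rewardedInf {v : ℝ → ℝ≥0∞} (hv : Measurable v) (lam : ℝ) {N : ℕ} {L : ℝ}
    (hL : 0 < L) (hN : 1 ≤ N) :
    ENNReal.ofReal (Real.pi ^ 2 / (8 * L ^ 2)) ≤ rewardedInf v lam N L :=
  (dirichlet_wall hv hL hN).trans (groundStateEnergy_le_rewardedInf v lam N L)

/-- At reward `0` the rewarded functional is the energy. [folklore] -/
theorem rewardedEnergy_zero (v : ℝ → ℝ≥0∞) {N : ℕ} {L : ℝ} (Ψ : TrialState N L) :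
    rewardedEnergy v 0 Ψ = energy v Ψ := by
  simp [rewardedEnergy]

/-- At reward `0` the rewarded infimum is the Dirichlet ground-state energy. [folklore] -/
theorem rewardedInf_zero (v : ℝ → ℝ≥0∞) (N : ℕ) (L : ℝ) :
    rewardedInf v 0 N L = groundStateEnergy v N L := by
  simp [rewardedInf, rewardedEnergy_zero, groundStateEnergy]

/-- Rewarded box BEC is monotone in the constant. [folklore] -/
theorem RewardedBoxBECAt.mono {v : ℝ → ℝ≥0∞} {ρ lam c c' : ℝ} (hcc' : c' ≤ c)
    (h : RewardedBoxBECAt v ρ lam c) : RewardedBoxBECAt v ρ lam c' := by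
  refine Filter.Eventually.mono h fun N hN => ?_
  obtain ⟨δ, hδ, hΨ⟩ := hN
  exact ⟨δ, hδ, fun Ψ hE => le_trans
    (ENNReal.ofReal_le_ofReal (mul_le_mul_of_nonneg_right hcc' N.cast_nonneg)) (hΨ Ψ hE)⟩

/-- Torus BEC is monotone in the constant. [folklore] -/
theorem TorusBECAt.mono {v : ℝ → ℝ≥0∞} {ρ c c' : ℝ} (hcc' : c' ≤ c)
    (h : TorusBECAt v ρ c) : TorusBECAt v ρ c' := by
  refine Filter.Eventually.mono h fun N hN => ?_
  obtain ⟨δ, hδ, hΨ⟩ := hN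
  exact ⟨δ, hδ, fun Ψ hE => le_trans
    (ENNReal.ofReal_le_ofReal (mul_le_mul_of_nonneg_right hcc' N.cast_nonneg)) (hΨ Ψ hE)⟩

/-- **Glue: flat-mode BEC of the unrewarded Dirichlet near-minimisers at density `ρ` gives
`HasGroundStateBEC v ρ`** (`⟨φ, γ_Ψ φ⟩ ≤ λ_max(γ_Ψ)` for the measurable normalised flat mode, then
`le_condensateNumber`; LSSY 2005 §1.2 (1.17)–(1.19)). [folklore] -/
theorem hasGroundStateBEC_of_rewardedBoxBECAt_zero {v : ℝ → ℝ≥0∞} {ρ c : ℝ} (hρ : 0 < ρ)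
    (hc : 0 < c) (h : RewardedBoxBECAt v ρ 0 c) : HasGroundStateBEC v ρ := by
  refine ⟨c, hc, ?_⟩
  filter_upwards [h, eventually_gt_atTop 0] with N hN hNpos
  obtain ⟨δ, hδ, hΨ⟩ := hN
  have hL : 0 < sideLength ρ N := by
    unfold sideLength
    exact Real.rpow_pos_of_pos (div_pos (Nat.cast_pos.mpr hNpos) hρ) _
  refine le_condensateNumber v hδ fun Ψ hE => ?_
  have hE' : rewardedEnergy v 0 Ψ ≤ rewardedInf v 0 N (sideLength ρ N) + δ := by
    rwa [rewardedEnergy_zero, rewardedInf_zero]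
  exact (hΨ Ψ hE').trans (occupation_le_maxOccupation _
    (_root_.AtomisticToContinuum.BECInfraredBound.aestronglyMeasurable_constMode _)
    (_root_.AtomisticToContinuum.BECInfraredBound.lintegral_constMode_sq hL))

/-! ## Statements of the registered stubs of the skeleton

Named `Prop`s, deliberately untagged (they are statements of a proof plan, each with the mechanism
that makes it plausible, not results in print); the skeleton's `stub_*` theorems assert them. -/

/-- **Stub statement — energy of the cut-off state at a fixed shift** (Basti–Cenatiempo–Schlein
2021, App. A, Lemma A.1 without the average over shifts): there is a universal `C` such that for
every cut-off profile `q` on the period `L ≥ 2ℓ > 0` (`C¹`, values in `[0,1]`, partition of unity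
`∑_m q(t - Lm)² = 1`, slope `|q'| ≤ D` supported on the ramps `[0,2ℓ] ∪ [L, L+2ℓ]` — the profile of
`exists_smooth_cutoff` has all of these with `D = c/ℓ`), every measurable `v ≥ 0`, every Young
parameter `η > 0`, every shift `u` and every periodic trial state `Ψ`, the raw energy of the cut-off
function `Φ_u(X) = Ψ(X + u) ∏_{i,k} q(x_{ik})` satisfies
`⟨Φ_u, HΦ_u⟩ ≤ (1 + Cη) ⟨Ψ, HΨ⟩_per + C (1 + η⁻¹) D² N`.
Mechanism: `energyIntegral_cutoffState_le_eta` (kinetic cross term by Young on the ramps,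
`interaction ≤ periodicInteraction`, unfolding against the partition of unity) and the ramp
multiplicity `∑_n 1_{ramps}(s - Ln) ≤ 4` for a single shift (cf. `tsum_indicator_Icc_sub_le_two`);
the kinetic integral over the cell is `≤ periodicEnergy`, `∑_{i,k} ∫_{cell} |Ψ|² = 3N`. -/
def CutoffEnergy : Prop :=
  ∃ C : ℝ, 0 ≤ C ∧ ∀ (N : ℕ) (ℓ L D : ℝ) (q : ℝ → ℝ) (v : ℝ → ℝ≥0∞) (η : ℝ) (u : Space),
    0 < ℓ → 2 * ℓ ≤ L → Measurable v → 0 < η → ContDiff ℝ 1 q → (∀ t, 0 ≤ q t ∧ q t ≤ 1) →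
    (∀ t, ∑' m : ℤ, ENNReal.ofReal (q (t - L * m) ^ 2) = 1) → (∀ t, |deriv q t| ≤ D) →
    (∀ t, deriv q t ≠ 0 → t ∈ Set.Icc 0 (2 * ℓ) ∪ Set.Icc L (L + 2 * ℓ)) →
    ∀ Ψ : PeriodicTrialState N L,
      ∫⁻ X, kineticDensity (fun X : Config N =>
            Ψ.ψ (X + fun _ => u) * ((∏ p : Fin N × Fin 3, q (X p.1 p.2) : ℝ) : ℂ)) X +
          interaction v X *
            ((‖Ψ.ψ (X + fun _ => u) * ((∏ p : Fin N × Fin 3, q (X p.1 p.2) : ℝ) : ℂ)‖₊ : ℝ≥0∞)) ^ 2 ≤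
        (1 + ENNReal.ofReal (C * η)) * periodicEnergy v Ψ +
          ENNReal.ofReal (C * (1 + η⁻¹) * D ^ 2 * N)

/-- **Stub statement — padding states** (Ruelle 1969, §3.5.11, subadditivity over separated unit
cells): for a measurable `v` vanishing beyond `R ≥ 0` and `m` unit cells `subBox 1 (1 + R) (d j)`
at distinct lattice sites, `E(m, ⋃ⱼ cell_j) ≤ m · E₀^D(1, 1)` (one particle per cell;
`E₀^D(1,1) < ∞` by `groundStateEnergy_one_lt_top`). Mechanism: `infEnergy_biUnion_le` with
`n ≡ 1`, `infEnergy_translate_le`, `groundStateEnergy_eq_infEnergy`. -/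
def PaddingStates : Prop :=
  ∀ (v : ℝ → ℝ≥0∞) (R : ℝ), Measurable v → (∀ r, R < r → v r = 0) → 0 ≤ R →
    ∀ (m : ℕ) (d : Fin m → Fin 3 → ℕ), Function.Injective d →
      infEnergy v m (⋃ j, subBox 1 (1 + R) (d j)) ≤ m * groundStateEnergy v 1 1

/-- **Stub statement — flat modes of nested boxes**: a wave function supported in `Λ_L^N`,
`0 < L ≤ L'`, has `n_{φ_{L'}} = (L/L')³ n_{φ_L}` (both flat modes are constant on the support, with
ratio `(L/L')^{3/2}`; `∫ conj φ · Ψ` scales, no integrability needed). -/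
def FlatModeNested : Prop :=
  ∀ {N : ℕ} {L L' : ℝ}, 0 < L → L ≤ L' → ∀ Ψ : Config N → ℂ, (∀ X, Ψ X ≠ 0 → ∀ i, X i ∈ box L) →
    occupation N (boxConstantMode L') Ψ =
      ENNReal.ofReal ((L / L') ^ 3) * occupation N (boxConstantMode L) Ψ

/-- **Stub statement — flat-mode occupation of the cut-off state** (the line's new transport
estimate; the map `γ ↦ QγQ` of Basti–Cenatiempo–Schlein 2021, App. A): there is a universal `C`
such that for every cut-off profile `q` on the period `L ≥ 2ℓ > 0` (continuous, values in `[0,1]`,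
supported in `(0, L+2ℓ)`, partition of unity `∑_m q(t - Lm)² = 1`) and every periodic trial state
`Ψ` of `N` particles on the torus of side `L`, the constant-mode occupation of `Ψ` is at most
`((L+2ℓ)/L)³` times the flat-mode (`boxConstantMode`) occupation of the cut-off function at shift
`0`, `Φ_0(X) = Ψ(X + 0) ∏_{i,k} q(x_{ik})`, in the box `Λ_{L+2ℓ}`, up to `C N √(ℓ/L)`:
`n₀(Ψ) ≤ ((L+2ℓ)/L)³ n_φ(Φ_0) + C N √(ℓ/L)`.
Mechanism (no positivity of `Ψ`): with `X = (x, Y)`, `∫ Φ_0(x,Y) dx = ∏ⱼ Q(yⱼ) ∫ Ψ(x,Y) Q(x) dx`,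
so unfolding the `Y`-integral against `∑_z Q(· + Lz)² = 1` (`lintegral_comp_add_mul_prodWeight`)
gives `n_φ(Φ_0) = (N/(L+2ℓ)³) ∫_{cell^{N-1}} |∫ Ψ(x,Y) Q(x) dx|² dY`, while
`n₀(Ψ) = (N/L³) ∫_{cell^{N-1}} |∫_{cell} Ψ(x,Y) dx|² dY` (`condensateOccupation_succ`); the two
inner integrals differ by `∫ Ψ(x,Y) w(x) dx` with `|w| ≤ 1` supported in
`S = [0, L+2ℓ]³ ∖ (2ℓ, L)³`, `|S| ≤ 16 L² ℓ`, and `∫_Y |∫_S Ψ|² ≤ |S| · ∫_{S × cell^{N-1}} |Ψ|² ≤ 8|S|`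
(periodicity: `S` meets 8 cells); expand the square and use Cauchy–Schwarz for the cross term. -/
def CutoffOccupation : Prop :=
  ∃ C : ℝ, 0 ≤ C ∧ ∀ (N : ℕ) (ℓ L : ℝ) (q : ℝ → ℝ), 0 < ℓ → 2 * ℓ ≤ L → Continuous q →
    (∀ t, 0 ≤ q t ∧ q t ≤ 1) → (∀ t, q t ≠ 0 → t ∈ Set.Ioo 0 (L + 2 * ℓ)) →
    (∀ t, ∑' m : ℤ, ENNReal.ofReal (q (t - L * m) ^ 2) = 1) →
    ∀ Ψ : PeriodicTrialState N L,
      condensateOccupation N L Ψ.ψ ≤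
        ENNReal.ofReal (((L + 2 * ℓ) / L) ^ 3) *
            occupation N (boxConstantMode (L + 2 * ℓ)) (fun X : Config N =>
              Ψ.ψ (X + fun _ => (0 : Space)) * ((∏ p : Fin N × Fin 3, q (X p.1 p.2) : ℝ) : ℂ)) +
          ENNReal.ofReal (C * N * Real.sqrt (ℓ / L))

/-- **Stub statement — occupations are superadditive under merging** (the one-particle density
matrix of the normalised symmetrised product of states with disjoint supports is `γ₁ ⊕ γ₂`, Ruelle
1969 §3.5.11 merge; only `≥ γ₁` is needed): for `SupportedState`s `Ψ₁`, `Ψ₂` on disjoint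
measurable regions and a measurable mode `φ`, `⟨φ, γ_{Ψ₁} φ⟩ ≤ ⟨φ, γ_{merge} φ⟩`. Mechanism: for
`Y` with exactly `N₁ - 1` particles in `U₁` and `N₂` in `U₂` (in the slots `A ⊂ Fin (N₁+N₂-1)`),
`x ↦ merge(x, Y)` equals `s N₁! N₂! Ψ₂(Y_{Aᶜ}) Ψ₁(x, Y_A)` (`symSum_eq_of_permAdm`,
`normSq_symSum`), the other `Y` contribute `≥ 0`; summing over the `C(N₁+N₂-1, N₁-1)` slot
patterns with `s² = 1/((N₁+N₂)! N₁! N₂!)` (`mergeScale_sq_mul`) gives exactly `⟨φ, γ_{Ψ₁} φ⟩`. -/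
def MergeOccupation : Prop :=
  ∀ {N₁ N₂ : ℕ} {U₁ U₂ : Set Space} (hdisj : Disjoint U₁ U₂), MeasurableSet U₁ → MeasurableSet U₂ →
    ∀ (Ψ₁ : SupportedState N₁ U₁) (Ψ₂ : SupportedState N₂ U₂) (φ : Space → ℂ),
      AEStronglyMeasurable φ volume →
        occupation N₁ φ Ψ₁.ψ ≤ occupation (N₁ + N₂) φ (Ψ₁.merge Ψ₂ hdisj).ψ

/-- **Stub statement — the padded cut-off state** (planner's stub 1, verbatim up to the name of
the flat mode; the assembly of `CutoffEnergy`, `PaddingStates`, `FlatModeNested`,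
`CutoffOccupation`, `MergeOccupation`). For every repulsive finite-range `v` there is a density
cap `ρ̄ > 0` (order `R₀⁻³`, room for `R₀`-separated padding) such that for `0 < ρ ≤ ρ̄` and every
`θ > 0` there is `M₀` with: for every `M ≥ M₀` there are `C, N₀` such that for all `N ≥ N₀`, all
`N''` with `(1 + 7/M) N ≤ N'' ≤ (1 + 7/M) N + 3`, and EVERY periodic trial state `Ψ` of `N`
particles on the torus of side `L_N(ρ)`, there is a Dirichlet trial state `Φ` of `N''` particles in
the box of side EXACTLY `L_{N''}(ρ)` with `⟨Φ,HΦ⟩ ≤ (1 + θ) ⟨Ψ,HΨ⟩_per + C (1 + N/L_N²) + θ N`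
and `n_φ(Φ) ≥ (N/N'')² (n₀(Ψ) - θ N)`.
Construction: `L = L_N(ρ) = 2ℓM`, cut-off state `Φ_0` in `Λ_{L(1+1/M)}` (`CutoffEnergy` with
`η ≍ θ`, `D = c/ℓ`, so `D²N = 4c²M² N/L²`; `CutoffOccupation` with `C√(1/(2M)) ≤ θ`), merged
(`SupportedState.merge`, `rawEnergy_merge`) with `m = N'' - N ≤ 7N/M + 3` one-particle states in
unit cells `subBox 1 (1+R) d` placed in the slab `{L(1+1/M) + R < x₀} ∩ Λ_{L''}` (width `≥ L/M`
for `M ≥ 17`, capacity `≥ N/(8ρM(1+R)³) ≥ m` for `ρ ≤ 1/(80(1+R)³)`, `N` large; `PaddingStates`: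
energy `≤ m E₀^D(1,1) + 1 ≤ θN + 3E₀^D(1,1) + 1` once `M ≥ 7E₀^D(1,1)/θ`); the flat-mode
occupation passes through `MergeOccupation` and `FlatModeNested`
(`(L'/L'')³ (L/L')³ = (L/L'')³ = N/N''`, `sideLength_pow_three`). -/
def PaddedCutoffState : Prop :=
  ∀ v : ℝ → ℝ≥0∞, IsRepulsiveFiniteRange v → ∃ ρbar : ℝ, 0 < ρbar ∧ ∀ ρ : ℝ, 0 < ρ → ρ ≤ ρbar →
    ∀ θ : ℝ, 0 < θ → ∃ M₀ : ℕ, ∀ M : ℕ, M₀ ≤ M → ∃ C : ℝ, ∃ N₀ : ℕ, ∀ N N'' : ℕ, N₀ ≤ N →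
      (1 + 7 / (M : ℝ)) * N ≤ N'' → (N'' : ℝ) ≤ (1 + 7 / (M : ℝ)) * N + 3 →
        ∀ Ψ : PeriodicTrialState N (sideLength ρ N), ∃ Φ : TrialState N'' (sideLength ρ N''),
          energy v Φ ≤ (1 + ENNReal.ofReal θ) * periodicEnergy v Ψ +
              ENNReal.ofReal (C * (1 + N / sideLength ρ N ^ 2) + θ * N) ∧
            ENNReal.ofReal (((N : ℝ) / N'') ^ 2) *
                (condensateOccupation N (sideLength ρ N) Ψ.ψ - ENNReal.ofReal (θ * N)) ≤
              occupation N'' (boxConstantMode (sideLength ρ N'')) Φ.ψ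

/-- **Stub statement — the rewarded upper bound from torus BEC** (planner's stub 2; uses the
crux hypothesis once, at `(v, ρ)`). Given the padded cut-off state, for every repulsive
finite-range `v` there is `ρ₁ > 0` (below the padding cap and the critical density) such that for
`0 < ρ < ρ₁` and `0 < c ≤ 1`, `TorusBECAt v ρ c → RewardedUpperBound v ρ c`. Mechanism: given
`θ₀`, `λ ≥ 0` fix `θ ≪ θ₀`, `M ≥ M₀(θ)`; every large `N''` is `∈ [(1+7/M)N, (1+7/M)N+3]` for
`N = ⌊N''/(1+7/M)⌋`; `TorusBECAt` at `N` gives `δ_A`; a periodic trial state within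
`min(δ_A, θN)` of `E₀^per(N, L_N) < ∞` (`iInf_lt_iff`;
`tendsto_energyPerParticlePeriodic_of_lt_criticalDensity`, LSSY 2005 Ch. 2 after (2.2)) has
`n₀ ≥ cN`; feed it to `PaddedCutoffState` and evaluate `R_λ(Φ)/N''`. -/
def RewardedUpperBoundOfTorusBEC : Prop :=
  PaddedCutoffState →
    ∀ v : ℝ → ℝ≥0∞, IsRepulsiveFiniteRange v → ∃ ρ₁ : ℝ, 0 < ρ₁ ∧ ∀ ρ : ℝ, 0 < ρ → ρ < ρ₁ →
      ∀ c : ℝ, 0 < c → c ≤ 1 → TorusBECAt v ρ c → RewardedUpperBound v ρ c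

/-- **Stub statement — the reward sandwich** (planner's stub 3; Griffiths 1966 §II variational
argument against the exact Dirichlet floor): for every repulsive finite-range `v` there is
`ρ₂ > 0` (below the critical density) such that for `0 < ρ < ρ₂`, `0 < c ≤ 1`,
`RewardedUpperBound v ρ c → ∀ λ > 0, RewardedBoxBECAt v ρ λ (c/2)`. Mechanism: for a
`δ`-near-minimiser `Ψ` of `R_λ`, `λ(N - n_φ) + E₀^D ≤ R_λ(Ψ) ≤ F^D(λ) + δ`; with
`θ = min(c/8, λc/8)`, `ε = λc/8` in `E₀^D ≥ N(e₀ - ε)` (`tendsto_e0_offCritical`) and `δ = λcN/8`: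
`1 - n_φ/N ≤ 1 - c/2`. -/
def RewardSandwich : Prop :=
  ∀ v : ℝ → ℝ≥0∞, IsRepulsiveFiniteRange v → ∃ ρ₂ : ℝ, 0 < ρ₂ ∧ ∀ ρ : ℝ, 0 < ρ → ρ < ρ₂ →
    ∀ c : ℝ, 0 < c → c ≤ 1 → RewardedUpperBound v ρ c →
      ∀ lam : ℝ, 0 < lam → RewardedBoxBECAt v ρ lam (c / 2)

/-- **Stub statement — un-rewarding** (planner's stub 4, the line's OPEN residual, held by the
lead): for every repulsive finite-range `v` there is `ρ₃ > 0` such that for `0 < ρ < ρ₃` and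
`c > 0`, if the rewarded Dirichlet near-minimisers are flat-mode condensed with the SAME constant
`c` at EVERY reward `λ > 0`, then the unrewarded Dirichlet near-minimisers are flat-mode condensed
with SOME constant `c' > 0`. It IS the `λ → 0⁺`/`N → ∞` interchange for a number-conserving reward
in one cube at `T = 0` (LSSY 2005 App. D's open converse of (D.17), costume-free); the barrier
`SymmetryBreakingWithoutCondensate` bites it. Consistency: at `v = 0` the conclusion holds outright
(`BoseGasFreeDirichletBEC`). -/
def Unrewarding : Prop :=
  ∀ v : ℝ → ℝ≥0∞, IsRepulsiveFiniteRange v → ∃ ρ₃ : ℝ, 0 < ρ₃ ∧ ∀ ρ : ℝ, 0 < ρ → ρ < ρ₃ →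
    ∀ c : ℝ, 0 < c → (∀ lam : ℝ, 0 < lam → RewardedBoxBECAt v ρ lam c) →
      ∃ c' : ℝ, 0 < c' ∧ RewardedBoxBECAt v ρ 0 c'

/-! ## The registered stub this file lands with -/

/-- **Stub 1a of the skeleton** (`Lines/reward-pays-the-wall.lean`): energy of the cut-off state at
a fixed shift, padding states in separated unit cells, flat modes of nested boxes — each is a
generic Literature theorem (`energyIntegral_cutoffState_le_single_shift` of
`BoseGasCutoffStateEnergy.lean`, `infEnergy_iUnion_subBox_le` of `BoseGasPaddingStates.lean`,
`occupation_boxConstantMode_of_support` of `BoseGasBoxModeNested.lean`), assembled. -/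
theorem stub_cutoffEnergy : CutoffEnergy ∧ PaddingStates ∧ FlatModeNested :=
  ⟨energyIntegral_cutoffState_le_single_shift, infEnergy_iUnion_subBox_le,
    @occupation_boxConstantMode_of_support⟩

end Summit.AtomisticToContinuum.BoseEinsteinCondensation.RewardPaysTheWall

end
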